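import Summits.BirchSwinnertonDyer.BirchSwinnertonDyer.Theorems.BiquadraticEisensteinDescentHeegnerTwistCouplingInSupplyQuarticMinusTripleDescentDual
import Summits.BirchSwinnertonDyer.BirchSwinnertonDyer.Theorems.BiquadraticEisensteinDescentHeegnerTwistCouplingInSupplyQuarticLocal
import HarnessLib

set_option linter.dupNamespace false -- `Summit.BirchSwinnertonDyer.BirchSwinnertonDyer.Theorems.…` (summit = sub)
set_option autoImplicit false

/-!
# Crux `HeegnerTwistCouplingInSupply` (stmt-BirchSwinnertonDyer-21381) — the QUARTIC `j = 1728` corner, CUBE member `W_{p³}⁻ : y² = x³ − p³·x`,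
# TRIPLE TWIST: `S(0, −s²q²ℓ²p³) = {1, −p}` and `S(0, 4s²q²ℓ²p³) = {1, p}`

Route `BiquadraticEisensteinDescent` (cell `pub/bsd-wall`, width seat `bsd-wall-cm-bed-w4` g14; `--supports` 21381, helper). The `p`-twist
`W_{p³}⁻ : y² = x³ − p³x` of the H⁻ corner curve (`p ≡ 7 (mod 8)`: `j = 1728`, CM by `ℤ[i]`, `p` inert and bad of Kodaira type III*, `Δ = 64p⁹`
minimal, odd `2`-Selmer parity) is a second globally minimal CM curve in the crux's inert-bad corner, distinct from `W_p⁻` (bed-w4 g13's memo §5 (c),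
«twists by `p`», untreated). Numerically the triple law of `…QuarticMinusTripleDescent` — twist by `d = −sqℓ`, `s ≡ 1`, `q ≡ 3`, `ℓ ≡ 5 (mod 8)`,
`(s/p) = (q/p) = (ℓ/p) = −1` — is sharp for the cube member too (164/164, `p < 150`, `|d| < 1.2·10⁴`); this file proves it:
★ `mem_selmer_neg_iff_triple_cube` (`S(0, −s²q²ℓ²p³) = {1, −p}`) and ★ `mem_selmer_pos_iff_triple_cube` (`S(0, 4s²q²ℓ²p³) = {1, p}`).

The strips at `s`, `ℓ` (and `q` on the dual side) are the generic kill `not_mem_selmer_of_prime_dvd` verbatim (`−b₀ = p³·□ = p·□`, resp. `−p·□`);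
the `2`-adic kills are those of the `k = 1` files (`p³ ≡ p (mod 8)`); only the four `p`-adic kills change (`v_p(b) = 3`: the classes `−1`, `q` die by
`…QuarticLocal.not_isSoluble_padic_of_nonsquare_of_cube_mul`, the classes `p`, `−pq` by `…QuarticLocal.not_isSoluble_padic_of_dvd_of_sq_mul`).
HONEST FRAMING: a typed sub-corner on one CM family (measure zero in «all CM `W`»); the crux (residual C⁺) is untouched; BSD is not proved by any
of this. THEOREMS ONLY. Supports stmt-BirchSwinnertonDyer-21381.
-/

noncomputable section

open scoped Classical

namespace Summit.BirchSwinnertonDyer.BirchSwinnertonDyer.Theorems.BiquadraticEisensteinDescentHeegnerTwistCouplingInSupplyQuarticMinusTripleCubeDescent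

open Literature.NumberTheory.EllipticCurves Literature.NumberTheory.EllipticCurves.XCubeAddPX
  Summit.BirchSwinnertonDyer.BirchSwinnertonDyer.Theorems.BiquadraticEisensteinDescentHeegnerTwistCouplingInSupplyQuarticTwistLocal
  Summit.BirchSwinnertonDyer.BirchSwinnertonDyer.Theorems.BiquadraticEisensteinDescentHeegnerTwistCouplingInSupplyQuarticTwistDescent
  Summit.BirchSwinnertonDyer.BirchSwinnertonDyer.Theorems.BiquadraticEisensteinDescentHeegnerTwistCouplingInSupplyQuarticTwistDescentDual
  Summit.BirchSwinnertonDyer.BirchSwinnertonDyer.Theorems.BiquadraticEisensteinDescentHeegnerTwistCouplingInSupplyQuarticMinusTripleDescent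
  Summit.BirchSwinnertonDyer.BirchSwinnertonDyer.Theorems.BiquadraticEisensteinDescentHeegnerTwistCouplingInSupplyQuarticMinusTripleDescentDual
  Summit.BirchSwinnertonDyer.BirchSwinnertonDyer.Theorems.BiquadraticEisensteinDescentHeegnerTwistCouplingInSupplyQuarticLocal

variable {p q s l : ℕ} [hp : Fact p.Prime] [hq : Fact q.Prime] [hs : Fact s.Prime] [hl : Fact l.Prime]

/-! ## §1 Residues for the cube member -/

omit hp hq hs hl in
/-- In `𝔽_t`: `a·(x·x)` is a non-square for `a` a non-square and `x ≠ 0`. [folklore] -/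
theorem not_isSquare_mul_sq {t : ℕ} [Fact t.Prime] {a x : ZMod t} (ha : ¬ IsSquare a) (hx : x ≠ 0) : ¬ IsSquare (a * (x * x)) :=
  not_isSquare_mul_of_isSquare ha ⟨_, rfl⟩ (mul_ne_zero hx hx)

omit hp hq hl in
/-- Strip at `s`: `−b₀ = q²ℓ²p³ = p·(qℓp)²` is a non-residue mod `s` when `(p/s) = −1`, `s ∤ qℓp`. [folklore] -/
theorem not_isSquare_strip_s_cube (hps : ¬ IsSquare ((p : ℤ) : ZMod s)) (h0 : (((q * l * p : ℕ) : ℤ) : ZMod s) ≠ 0) :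
    ¬ IsSquare (((-(-(q ^ 2 * l ^ 2 * p ^ 3)) : ℤ)) : ZMod s) := by
  rw [show (((-(-(q ^ 2 * l ^ 2 * p ^ 3)) : ℤ)) : ZMod s) = ((p : ℤ) : ZMod s) * ((((q * l * p : ℕ) : ℤ) : ZMod s) * (((q * l * p : ℕ) : ℤ) : ZMod s))
    by push_cast; ring]
  exact not_isSquare_mul_sq hps h0

omit hp hq hs in
/-- Strip at `ℓ`: `−b₀ = s²q²p³ = p·(sqp)²` is a non-residue mod `ℓ` when `(p/ℓ) = −1`, `ℓ ∤ sqp`. [folklore] -/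
theorem not_isSquare_strip_l_cube (hpl : ¬ IsSquare ((p : ℤ) : ZMod l)) (h0 : (((s * q * p : ℕ) : ℤ) : ZMod l) ≠ 0) :
    ¬ IsSquare (((-(-(s ^ 2 * q ^ 2 * p ^ 3)) : ℤ)) : ZMod l) := by
  rw [show (((-(-(s ^ 2 * q ^ 2 * p ^ 3)) : ℤ)) : ZMod l) = ((p : ℤ) : ZMod l) * ((((s * q * p : ℕ) : ℤ) : ZMod l) * (((s * q * p : ℕ) : ℤ) : ZMod l))
    by push_cast; ring]
  exact not_isSquare_mul_sq hpl h0

omit hp hq hl in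
/-- Dual strip at `s ≡ 1 (mod 4)`: `−b₀ = −4q²ℓ²p³ = p·(2iqℓp)²`, `i² = −1`, a non-residue mod `s`. [folklore] -/
theorem not_isSquare_strip_s_cube_dual (hs4 : s % 4 = 1) (hps : ¬ IsSquare ((p : ℤ) : ZMod s)) (h0 : (((2 * q * l * p : ℕ) : ℤ) : ZMod s) ≠ 0) :
    ¬ IsSquare (((-(4 * q ^ 2 * l ^ 2 * p ^ 3) : ℤ)) : ZMod s) := by
  obtain ⟨i, hi⟩ := (ZMod.exists_sq_eq_neg_one_iff (p := s)).mpr (by omega)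
  have hi0 : i ≠ 0 := by rintro rfl; simp at hi
  have e : (((-(4 * q ^ 2 * l ^ 2 * p ^ 3) : ℤ)) : ZMod s) =
      ((p : ℤ) : ZMod s) * ((i * (((2 * q * l * p : ℕ) : ℤ) : ZMod s)) * (i * (((2 * q * l * p : ℕ) : ℤ) : ZMod s))) := by
    push_cast
    linear_combination (4 * (q : ZMod s) ^ 2 * (l : ZMod s) ^ 2 * (p : ZMod s) ^ 3) * hi
  rw [e]
  exact not_isSquare_mul_sq hps (mul_ne_zero hi0 h0)

omit hp hq hs in
/-- Dual strip at `ℓ ≡ 1 (mod 4)`: `−b₀ = −4s²q²p³` is a non-residue mod `ℓ`. [folklore] -/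
theorem not_isSquare_strip_l_cube_dual (hl4 : l % 4 = 1) (hpl : ¬ IsSquare ((p : ℤ) : ZMod l)) (h0 : (((2 * s * q * p : ℕ) : ℤ) : ZMod l) ≠ 0) :
    ¬ IsSquare (((-(4 * s ^ 2 * q ^ 2 * p ^ 3) : ℤ)) : ZMod l) := by
  obtain ⟨i, hi⟩ := (ZMod.exists_sq_eq_neg_one_iff (p := l)).mpr (by omega)
  have hi0 : i ≠ 0 := by rintro rfl; simp at hi
  have e : (((-(4 * s ^ 2 * q ^ 2 * p ^ 3) : ℤ)) : ZMod l) =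
      ((p : ℤ) : ZMod l) * ((i * (((2 * s * q * p : ℕ) : ℤ) : ZMod l)) * (i * (((2 * s * q * p : ℕ) : ℤ) : ZMod l))) := by
    push_cast
    linear_combination (4 * (s : ZMod l) ^ 2 * (q : ZMod l) ^ 2 * (p : ZMod l) ^ 3) * hi
  rw [e]
  exact not_isSquare_mul_sq hpl (mul_ne_zero hi0 h0)

omit hp hs hl in
/-- Dual strip at `q ≡ 3 (mod 4)`: `−b₀ = −4s²ℓ²p³ = (−1)·(2sℓpr)²`, `r² = p`, a non-residue mod `q` (`(p/q) = +1`, `−1` a non-residue). [folklore] -/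
theorem not_isSquare_strip_q_cube_dual (hq4 : q % 4 = 3) (hpq : IsSquare ((p : ℤ) : ZMod q)) (h0 : (((2 * s * l * p : ℕ) : ℤ) : ZMod q) ≠ 0) :
    ¬ IsSquare (((-(4 * s ^ 2 * l ^ 2 * p ^ 3) : ℤ)) : ZMod q) := by
  obtain ⟨r, hr⟩ := hpq
  have hr' : (p : ZMod q) = r * r := by exact_mod_cast hr
  have hr0 : r ≠ 0 := by
    rintro rfl
    apply h0
    push_cast
    rw [hr', mul_zero, mul_zero]
  have hm1 : ¬ IsSquare (((-1 : ℤ)) : ZMod q) := not_isSquare_neg_one (p := q) hq4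
  have e : (((-(4 * s ^ 2 * l ^ 2 * p ^ 3) : ℤ)) : ZMod q) =
      (((-1 : ℤ)) : ZMod q) * ((r * (((2 * s * l * p : ℕ) : ℤ) : ZMod q)) * (r * (((2 * s * l * p : ℕ) : ℤ) : ZMod q))) := by
    push_cast
    linear_combination (-(4 : ZMod q) * (s : ZMod q) ^ 2 * (l : ZMod q) ^ 2 * (p : ZMod q) ^ 2) * hr'
  rw [e]
  exact not_isSquare_mul_sq hm1 (mul_ne_zero hr0 h0)

omit hp hs hl in
/-- The cofactors at `q` for the dual classes `2`, `2p` of the cube member: `2`, `2p`, `2s²ℓ²p³`, `2s²ℓ²p²` are non-residues mod `q ≡ 3 (mod 8)`.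
[folklore] -/
theorem nonresidues_mod_q_cube_dual (hq8 : q % 8 = 3) (hpq : IsSquare ((p : ℤ) : ZMod q)) (hp0 : ((p : ℤ) : ZMod q) ≠ 0)
    (hsl0 : (((s * l : ℕ) : ℤ) : ZMod q) ≠ 0) :
    ¬ IsSquare (((2 : ℤ)) : ZMod q) ∧ ¬ IsSquare (((2 * p : ℤ)) : ZMod q) ∧
      ¬ IsSquare (((2 * s ^ 2 * l ^ 2 * p ^ 3 : ℤ)) : ZMod q) ∧ ¬ IsSquare (((2 * s ^ 2 * l ^ 2 * p ^ 2 : ℤ)) : ZMod q) := by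
  have h2 := not_isSquare_two_mod_q (q := q) hq8
  obtain ⟨r, hr⟩ := hpq
  have hr' : (p : ZMod q) = r * r := by exact_mod_cast hr
  have hp0' : (p : ZMod q) ≠ 0 := by exact_mod_cast hp0
  have hr0 : r ≠ 0 := by rintro rfl; exact hp0' (by rw [hr', mul_zero])
  have hsl0' : (((s * l : ℕ) : ℤ) : ZMod q) * r ≠ 0 := mul_ne_zero hsl0 hr0
  refine ⟨h2, ?_, ?_, ?_⟩
  · rw [show (((2 * p : ℤ)) : ZMod q) = (((2 : ℤ)) : ZMod q) * (r * r) by push_cast; rw [hr']]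
    exact not_isSquare_mul_sq h2 hr0
  · rw [show (((2 * s ^ 2 * l ^ 2 * p ^ 3 : ℤ)) : ZMod q) = (((2 : ℤ)) : ZMod q) *
        (((((s * l : ℕ) : ℤ) : ZMod q) * r * (p : ZMod q)) * ((((s * l : ℕ) : ℤ) : ZMod q) * r * (p : ZMod q))) by
          push_cast; rw [hr']; ring]
    exact not_isSquare_mul_sq h2 (mul_ne_zero hsl0' hp0')
  · rw [show (((2 * s ^ 2 * l ^ 2 * p ^ 2 : ℤ)) : ZMod q) = (((2 : ℤ)) : ZMod q) *
        (((((s * l : ℕ) : ℤ) : ZMod q) * (p : ZMod q)) * ((((s * l : ℕ) : ℤ) : ZMod q) * (p : ZMod q))) by push_cast; ring]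
    exact not_isSquare_mul_sq h2 (mul_ne_zero hsl0 hp0')

/-! ## §2 The side `S(0, −s²q²ℓ²p³) = {1, −p}` -/

omit hs hl in
/-- The squarefree divisors of `s²q²ℓ²p³` prime to `s` and `ℓ`: absolute values among `1, q, p, qp`. [folklore] -/
theorem natAbs_eq_of_squarefree_dvd_cube {d : ℤ} (hsq : Squarefree d) (hdvd : d ∣ (s ^ 2 * q ^ 2 * l ^ 2 * p ^ 3 : ℤ))
    (hsP : s.Prime) (hlP : l.Prime) (hsd : ¬ (s : ℤ) ∣ d) (hld : ¬ (l : ℤ) ∣ d) :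
    d.natAbs = 1 ∨ d.natAbs = q ∨ d.natAbs = p ∨ d.natAbs = q * p := by
  refine natAbs_eq_of_squarefree_dvd_triple (p := p) (q := q) (s := s) (l := l) hsq ?_ hsP hlP hsd hld
  have hrad : d ∣ (s * q * l * p : ℤ) := by
    have h2 : d ∣ (s * q * l * p : ℤ) ^ 3 := dvd_trans hdvd ⟨s * q * l, by ring⟩
    exact (hsq.dvd_pow_iff_dvd (by norm_num)).mp h2
  exact dvd_trans hrad ⟨s * q * l, by ring⟩

omit hp hq hs hl in
/-- **The two `2`-adic kills of the cube member** (`p³ ≡ p (mod 8)`): the classes `−q` and `pq`. [cite: SilvermanAEC2009, proof of Prop. X.6.2(b)] -/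
theorem two_adic_kills_cube (hs8 : s % 8 = 1) (hq8 : q % 8 = 3) (hl8 : l % 8 = 5) (hp8 : p % 8 = 7) :
    ¬ ((twoIsogenyQuartic 0 (-(q : ℤ)) (s ^ 2 * q * l ^ 2 * p ^ 3)).map (Int.castRingHom ℚ_[2])).IsSoluble ∧
    ¬ ((twoIsogenyQuartic 0 ((q : ℤ) * p) (-(s ^ 2 * q * l ^ 2 * p ^ 2 : ℤ))).map (Int.castRingHom ℚ_[2])).IsSoluble := by
  have hp' : (p : ZMod 8) = 7 := by simpa using natCast_zmod8_of_mod hp8 (by norm_num)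
  have hq' : (q : ZMod 8) = 3 := by simpa using natCast_zmod8_of_mod hq8 (by norm_num)
  have hs' : (s : ZMod 8) = 1 := by simpa using natCast_zmod8_of_mod hs8 (by norm_num)
  have hl' : (l : ZMod 8) = 5 := by simpa using natCast_zmod8_of_mod hl8 (by norm_num)
  refine ⟨not_isSoluble_two_of_zmod8 ?_, not_isSoluble_two_of_zmod8 ?_⟩ <;>
  · push_cast
    rw [hp', hq', hs', hl']
    decide

/-- ★ **`S(0, −s²q²ℓ²p³) = {1, −p}`** for primes `p ≡ 7 (mod 8)`, `s ≡ 1`, `q ≡ 3`, `ℓ ≡ 5 (mod 8)` with `(q/p) = −1`, `(p/s) = −1`, `(p/ℓ) = −1`: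
descent on the divisors of `b = −s²q²ℓ²p³` for the twist `W_{p³}⁻^{(−sqℓ)} : y² = x³ − s²q²ℓ²p³·x`. Legendre-only.
[cite: SilvermanAEC2009, Prop. X.4.9 and Prop. X.6.1] -/
theorem mem_selmer_neg_iff_triple_cube (hp8 : p % 8 = 7) (hs8 : s % 8 = 1) (hq8 : q % 8 = 3) (hl8 : l % 8 = 5)
    (hnq : ¬ IsSquare ((q : ℤ) : ZMod p)) (hps : ¬ IsSquare ((p : ℤ) : ZMod s)) (hpl : ¬ IsSquare ((p : ℤ) : ZMod l))
    (d : ℤ) :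
    d ∈ twoIsogenySelmerGroup 0 (-(s ^ 2 * q ^ 2 * l ^ 2 * p ^ 3 : ℤ)) ↔ d = 1 ∨ d = -(p : ℤ) := by
  have hP := hp.out
  have hQ := hq.out
  have hS := hs.out
  have hL := hl.out
  have hqp : q ≠ p := by rintro rfl; omega
  have hsp : s ≠ p := by rintro rfl; omega
  have hlp : l ≠ p := by rintro rfl; omega
  have hsq' : s ≠ q := by rintro rfl; omega
  have hsl : s ≠ l := by rintro rfl; omega
  have hql : q ≠ l := by rintro rfl; omega
  have hp0 : (p : ℤ) ≠ 0 := by exact_mod_cast hP.ne_zero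
  have hq0 : (q : ℤ) ≠ 0 := by exact_mod_cast hQ.ne_zero
  have hs0 : (s : ℤ) ≠ 0 := by exact_mod_cast hS.ne_zero
  have hl0 : (l : ℤ) ≠ 0 := by exact_mod_cast hL.ne_zero
  have hb : (-(s ^ 2 * q ^ 2 * l ^ 2 * p ^ 3 : ℤ)) ≠ 0 :=
    neg_ne_zero.mpr (mul_ne_zero (mul_ne_zero (mul_ne_zero (pow_ne_zero 2 hs0) (pow_ne_zero 2 hq0)) (pow_ne_zero 2 hl0)) (pow_ne_zero 3 hp0))
  have hpI : Prime (p : ℤ) := Nat.prime_iff_prime_int.mp hP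
  have ndvd : ∀ {a b : ℕ}, a.Prime → b.Prime → a ≠ b → ¬ a ∣ b := fun ha hb hab h =>
    hab ((Nat.prime_dvd_prime_iff_eq ha hb).mp h)
  -- cast non-vanishing
  have cast_ne3 : ∀ {t a b c : ℕ}, t.Prime → a.Prime → b.Prime → c.Prime → t ≠ a → t ≠ b → t ≠ c →
      (((a * b * c : ℕ) : ℤ) : ZMod t) ≠ 0 := fun {t a b c} ht ha hb hc hta htb htc h0 => by
    have h' : t ∣ a * b * c := by exact_mod_cast (ZMod.intCast_zmod_eq_zero_iff_dvd (a * b * c) t).mp h0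
    rcases (Nat.Prime.dvd_mul ht).mp h' with h | h
    · rcases (Nat.Prime.dvd_mul ht).mp h with h | h
      · exact ndvd ht ha hta h
      · exact ndvd ht hb htb h
    · exact ndvd ht hc htc h
  have hpsql : ¬ p ∣ s * q * l := fun h => by
    rcases (Nat.Prime.dvd_mul hP).mp h with h | h
    · rcases (Nat.Prime.dvd_mul hP).mp h with h | h
      · exact ndvd hP hS (Ne.symm hsp) h
      · exact ndvd hP hQ (Ne.symm hqp) h
    · exact ndvd hP hL (Ne.symm hlp) h
  obtain ⟨hm1, hmsq, hqsq⟩ := nonresidues_mod_p_triple (s := s) (l := l) (by omega) hnq hpsql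
  have hpm : ¬ (p : ℤ) ∣ (s ^ 2 * q ^ 2 * l ^ 2 : ℤ) := by
    intro h
    have h' : (p : ℤ) ∣ ((s * q * l : ℕ) : ℤ) ^ 2 := by
      rw [show (((s * q * l : ℕ) : ℤ)) ^ 2 = (s ^ 2 * q ^ 2 * l ^ 2 : ℤ) by push_cast; ring]; exact h
    exact hpsql (by exact_mod_cast hpI.dvd_of_dvd_pow h')
  have hpm' : ¬ (p : ℤ) ∣ (s ^ 2 * q * l ^ 2 : ℤ) := by
    intro h
    apply hpm
    rw [show (s ^ 2 * q ^ 2 * l ^ 2 : ℤ) = (s ^ 2 * q * l ^ 2) * q by ring]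
    exact h.mul_right _
  have hpq' : ¬ (p : ℤ) ∣ (q : ℤ) := fun h => hqp (((Nat.prime_dvd_prime_iff_eq hP hQ).mp (by exact_mod_cast h))).symm
  haveI : Fact (Nat.Prime 2) := ⟨Nat.prime_two⟩
  obtain ⟨k1, k2⟩ := two_adic_kills_cube (p := p) (q := q) (s := s) (l := l) hs8 hq8 hl8 hp8
  constructor
  · intro hd
    have hsqf := squarefree_of_mem_twoIsogenySelmerGroup hd
    have hd0 : d ≠ 0 := hsqf.ne_zero
    have hdvd : d ∣ (s ^ 2 * q ^ 2 * l ^ 2 * p ^ 3 : ℤ) := dvd_neg.mp (dvd_of_mem_twoIsogenySelmerGroup hd)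
    have hsd : ¬ (s : ℤ) ∣ d := fun h =>
      not_mem_selmer_of_prime_dvd (t := s) (b₀ := -(q ^ 2 * l ^ 2 * p ^ 3 : ℤ)) (by ring)
        (not_isSquare_strip_s_cube (p := p) hps (cast_ne3 hS hQ hL hP hsq' hsl hsp)) h hd
    have hld : ¬ (l : ℤ) ∣ d := fun h =>
      not_mem_selmer_of_prime_dvd (t := l) (b₀ := -(s ^ 2 * q ^ 2 * p ^ 3 : ℤ)) (by ring)
        (not_isSquare_strip_l_cube (p := p) hpl (cast_ne3 hL hS hQ hP (Ne.symm hsl) (Ne.symm hql) hlp)) h hd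
    have key : ∀ d' : ℤ, d * d' = -(s ^ 2 * q ^ 2 * l ^ 2 * p ^ 3 : ℤ) → (twoIsogenyQuartic 0 d d').IsLocallySoluble :=
      fun d' hdd => isLocallySoluble_of_mem hd0 hdd hd
    rcases natAbs_eq_of_squarefree_dvd_cube (p := p) (q := q) hsqf hdvd hS hL hsd hld with h | h | h | h <;>
      rcases Int.natAbs_eq d with hd' | hd' <;> rw [h] at hd' <;> push_cast at hd' <;> subst hd'
    · exact Or.inl rfl
    · -- d = -1 : dies at p (`c′ = p³·(sqℓ)²`, `−1` a non-residue)
      refine absurd ((key (s ^ 2 * q ^ 2 * l ^ 2 * p ^ 3) (by ring)).2 p) ?_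
      exact not_isSoluble_padic_of_nonsquare_of_cube_mul (r := p) (d := -1) (e' := s ^ 2 * q ^ 2 * l ^ 2) (by ring) hpm hm1
    · -- d = q : dies at p
      refine absurd ((key (-(s ^ 2 * q * l ^ 2 * p ^ 3)) (by ring)).2 p) ?_
      exact not_isSoluble_padic_of_nonsquare_of_cube_mul (r := p) (d := (q : ℤ)) (e' := -(s ^ 2 * q * l ^ 2)) (by ring)
        (by rwa [dvd_neg]) hnq
    · -- d = -q : dies at 2
      exact absurd ((key (s ^ 2 * q * l ^ 2 * p ^ 3) (by ring)).2 2) k1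
    · -- d = p : dies at p (`p ∥ c`, `c′ = p²·(−(sqℓ)²)`)
      refine absurd ((key (-(s ^ 2 * q ^ 2 * l ^ 2 * p ^ 2)) (by ring)).2 p) ?_
      exact not_isSoluble_padic_of_dvd_of_sq_mul (r := p) (d := (p : ℤ)) (d₁ := 1) (e' := -(s ^ 2 * q ^ 2 * l ^ 2)) (by ring)
        (fun h => hP.one_lt.ne' (by exact_mod_cast Int.eq_one_of_dvd_one (by positivity) h)) (by ring) hmsq
    · exact Or.inr rfl
    · -- d = qp : dies at 2
      exact absurd ((key (-(s ^ 2 * q * l ^ 2 * p ^ 2)) (by ring)).2 2) k2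
    · -- d = -qp : dies at p (`p ∥ c`, `c′ = p²·q(sℓ)²`)
      refine absurd ((key (s ^ 2 * q * l ^ 2 * p ^ 2) (by ring)).2 p) ?_
      exact not_isSoluble_padic_of_dvd_of_sq_mul (r := p) (d := -((q : ℤ) * p)) (d₁ := -(q : ℤ)) (e' := s ^ 2 * q * l ^ 2) (by ring)
        (by rwa [dvd_neg]) (by ring) hqsq
  · rintro (rfl | rfl)
    · exact one_mem_twoIsogenySelmerGroup 0 hb
    · refine mem_twoIsogenySelmerGroup_of_isSquare hb ?_ ⟨s ^ 2 * q ^ 2 * l ^ 2 * p ^ 2, by ring⟩ ⟨s * q * l * p, ?_⟩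
      · exact Int.squarefree_natAbs.mp (by rw [Int.natAbs_neg, Int.natAbs_natCast]; exact hP.prime.squarefree)
      · rw [show (-(s ^ 2 * q ^ 2 * l ^ 2 * p ^ 3 : ℤ)) = -(p : ℤ) * (s ^ 2 * q ^ 2 * l ^ 2 * p ^ 2) by ring,
          Int.mul_ediv_cancel_left _ (neg_ne_zero.mpr hp0)]
        ring

/-! ## §3 The side `S(0, 4s²q²ℓ²p³) = {1, p}` -/

omit hs hq hl in
/-- The positive squarefree divisors of `4s²q²ℓ²p³` prime to `s`, `q`, `ℓ`: `1, 2, p, 2p`. [folklore] -/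
theorem natAbs_eq_of_squarefree_dvd_cube_dual {d : ℤ} (hsq : Squarefree d) (hdvd : d ∣ (4 * s ^ 2 * q ^ 2 * l ^ 2 * p ^ 3 : ℤ))
    (hsP : s.Prime) (hqP : q.Prime) (hlP : l.Prime) (hsd : ¬ (s : ℤ) ∣ d) (hqd : ¬ (q : ℤ) ∣ d) (hld : ¬ (l : ℤ) ∣ d) :
    d.natAbs = 1 ∨ d.natAbs = 2 ∨ d.natAbs = p ∨ d.natAbs = 2 * p := by
  refine natAbs_eq_of_squarefree_dvd_triple_dual (p := p) (q := q) (s := s) (l := l) hsq ?_ hsP hqP hlP hsd hqd hld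
  have hrad : d ∣ (2 * s * q * l * p : ℤ) := by
    have h2 : d ∣ (2 * s * q * l * p : ℤ) ^ 3 := dvd_trans hdvd ⟨2 * s * q * l, by ring⟩
    exact (hsq.dvd_pow_iff_dvd (by norm_num)).mp h2
  exact dvd_trans hrad ⟨2 * s * q * l, by ring⟩

/-- ★ **`S(0, 4s²q²ℓ²p³) = {1, p}`** for primes `p ≡ 7 (mod 8)`, `s ≡ 1`, `q ≡ 3`, `ℓ ≡ 5 (mod 8)` with `(q/p) = −1`, `(p/s) = −1`, `(p/ℓ) = −1`:
descent on the divisors of `b′ = 4s²q²ℓ²p³` (Silverman's `S^{(φ)}(E/ℚ)` for the cube member). Legendre-only, no `2`-adic analysis.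
[cite: SilvermanAEC2009, Prop. X.4.9 and Prop. X.6.1] -/
theorem mem_selmer_pos_iff_triple_cube (hp8 : p % 8 = 7) (hs8 : s % 8 = 1) (hq8 : q % 8 = 3) (hl8 : l % 8 = 5)
    (hnq : ¬ IsSquare ((q : ℤ) : ZMod p)) (hps : ¬ IsSquare ((p : ℤ) : ZMod s)) (hpl : ¬ IsSquare ((p : ℤ) : ZMod l))
    (d : ℤ) :
    d ∈ twoIsogenySelmerGroup 0 (4 * s ^ 2 * q ^ 2 * l ^ 2 * p ^ 3 : ℤ) ↔ d = 1 ∨ d = (p : ℤ) := by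
  have hP := hp.out
  have hQ := hq.out
  have hS := hs.out
  have hL := hl.out
  have hqp : q ≠ p := by rintro rfl; omega
  have hsp : s ≠ p := by rintro rfl; omega
  have hlp : l ≠ p := by rintro rfl; omega
  have hsq' : s ≠ q := by rintro rfl; omega
  have hsl : s ≠ l := by rintro rfl; omega
  have hql : q ≠ l := by rintro rfl; omega
  have hp0 : (p : ℤ) ≠ 0 := by exact_mod_cast hP.ne_zero
  have hq0 : (q : ℤ) ≠ 0 := by exact_mod_cast hQ.ne_zero
  have hs0 : (s : ℤ) ≠ 0 := by exact_mod_cast hS.ne_zero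
  have hl0 : (l : ℤ) ≠ 0 := by exact_mod_cast hL.ne_zero
  have hbpos : (0 : ℤ) < 4 * s ^ 2 * q ^ 2 * l ^ 2 * p ^ 3 := by positivity
  have hb : (4 * s ^ 2 * q ^ 2 * l ^ 2 * p ^ 3 : ℤ) ≠ 0 := hbpos.ne'
  have ndvd : ∀ {a b : ℕ}, a.Prime → b.Prime → a ≠ b → ¬ a ∣ b := fun ha hb hab h =>
    hab ((Nat.prime_dvd_prime_iff_eq ha hb).mp h)
  have cast_ne : ∀ {a t : ℕ}, t.Prime → a.Prime → t ≠ a → ((a : ℤ) : ZMod t) ≠ 0 := fun {a t} htP haP hta h0 =>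
    hta ((Nat.prime_dvd_prime_iff_eq htP haP).mp (by exact_mod_cast (ZMod.intCast_zmod_eq_zero_iff_dvd a t).mp h0))
  -- products of four / two casts
  have cast_ne4 : ∀ {t a b c e : ℕ}, t.Prime → a.Prime → b.Prime → c.Prime → e.Prime → t ≠ a → t ≠ b → t ≠ c → t ≠ e →
      (((a * b * c * e : ℕ) : ℤ) : ZMod t) ≠ 0 := fun {t a b c e} ht ha hb hc he hta htb htc hte => by
    haveI := Fact.mk ht
    have := mul_ne_zero (mul_ne_zero (mul_ne_zero (cast_ne ht ha hta) (cast_ne ht hb htb)) (cast_ne ht hc htc)) (cast_ne ht he hte)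
    push_cast at this ⊢
    exact this
  have cast_ne2 : ∀ {t a b : ℕ}, t.Prime → a.Prime → b.Prime → t ≠ a → t ≠ b → (((a * b : ℕ) : ℤ) : ZMod t) ≠ 0 :=
    fun {t a b} ht ha hb hta htb => by
      haveI := Fact.mk ht
      have := mul_ne_zero (cast_ne ht ha hta) (cast_ne ht hb htb)
      push_cast at this ⊢
      exact this
  have h2s : s ≠ 2 := by rintro rfl; omega
  have h2l : l ≠ 2 := by rintro rfl; omega
  have h2q : q ≠ 2 := by rintro rfl; omega
  have hpq : IsSquare ((p : ℤ) : ZMod q) := isSquare_p_mod_q (p := p) (q := q) (by omega) (by omega) hnq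
  have strip_s := not_isSquare_strip_s_cube_dual (p := p) (q := q) (l := l) (by omega) hps
    (cast_ne4 hS Nat.prime_two hQ hL hP h2s hsq' hsl hsp)
  have strip_l := not_isSquare_strip_l_cube_dual (p := p) (q := q) (s := s) (by omega) hpl
    (cast_ne4 hL Nat.prime_two hS hQ hP h2l (Ne.symm hsl) (Ne.symm hql) hlp)
  have strip_q := not_isSquare_strip_q_cube_dual (s := s) (l := l) (by omega) hpq
    (cast_ne4 hQ Nat.prime_two hS hL hP h2q (Ne.symm hsq') hql hqp)
  obtain ⟨hn2, hn2p, hn2slp, hn2sl⟩ := nonresidues_mod_q_cube_dual (s := s) (l := l) hq8 hpq (cast_ne hQ hP hqp)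
    (cast_ne2 hQ hS hL (Ne.symm hsq') hql)
  haveI : Fact (Nat.Prime 2) := ⟨Nat.prime_two⟩
  constructor
  · intro hd
    have hsqf := squarefree_of_mem_twoIsogenySelmerGroup hd
    have hd0 : d ≠ 0 := hsqf.ne_zero
    have hdvd : d ∣ (4 * s ^ 2 * q ^ 2 * l ^ 2 * p ^ 3 : ℤ) := dvd_of_mem_twoIsogenySelmerGroup hd
    have key : ∀ d' : ℤ, d * d' = (4 * s ^ 2 * q ^ 2 * l ^ 2 * p ^ 3 : ℤ) → (twoIsogenyQuartic 0 d d').IsLocallySoluble :=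
      fun d' hdd => isLocallySoluble_of_mem hd0 hdd hd
    rcases lt_or_gt_of_ne hd0 with hneg | hpos
    · exfalso
      obtain ⟨d', hd'⟩ := hdvd
      have hd'neg : d' < 0 := by
        rcases pos_and_pos_or_neg_and_neg_of_mul_pos (show 0 < d * d' by rw [← hd']; exact hbpos) with ⟨h1, -⟩ | ⟨-, h2⟩
        · exact absurd h1 (not_lt.mpr hneg.le)
        · exact h2
      exact not_isSoluble_real_twoIsogenyQuartic_of_neg hneg hd'neg le_rfl (key d' hd'.symm).1
    have hsd : ¬ (s : ℤ) ∣ d := fun h =>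
      not_mem_selmer_of_prime_dvd (t := s) (b₀ := (4 * q ^ 2 * l ^ 2 * p ^ 3 : ℤ)) (by ring) strip_s h hd
    have hld : ¬ (l : ℤ) ∣ d := fun h =>
      not_mem_selmer_of_prime_dvd (t := l) (b₀ := (4 * s ^ 2 * q ^ 2 * p ^ 3 : ℤ)) (by ring) strip_l h hd
    have hqd : ¬ (q : ℤ) ∣ d := fun h =>
      not_mem_selmer_of_prime_dvd (t := q) (b₀ := (4 * s ^ 2 * l ^ 2 * p ^ 3 : ℤ)) (by ring) strip_q h hd
    have hdabs : d = (d.natAbs : ℤ) := (Int.natAbs_of_nonneg hpos.le).symm ▸ rfl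
    rcases natAbs_eq_of_squarefree_dvd_cube_dual (p := p) hsqf hdvd hS hQ hL hsd hqd hld with h | h | h | h <;>
      rw [h] at hdabs <;> push_cast at hdabs <;> subst hdabs
    · exact Or.inl rfl
    · -- d = 2 : dies at q
      refine absurd ((key (2 * s ^ 2 * q ^ 2 * l ^ 2 * p ^ 3) (by ring)).2 q) ?_
      exact not_isSoluble_padic_of_sq_mul (ℓ := q) (c := 2) (c' := 2 * s ^ 2 * q ^ 2 * l ^ 2 * p ^ 3) (c'' := 2 * s ^ 2 * l ^ 2 * p ^ 3)
        (by ring) hn2 hn2slp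
    · exact Or.inr rfl
    · -- d = 2p : dies at q
      refine absurd ((key (2 * s ^ 2 * q ^ 2 * l ^ 2 * p ^ 2) (by ring)).2 q) ?_
      exact not_isSoluble_padic_of_sq_mul (ℓ := q) (c := 2 * (p : ℤ)) (c' := 2 * s ^ 2 * q ^ 2 * l ^ 2 * p ^ 2)
        (c'' := 2 * s ^ 2 * l ^ 2 * p ^ 2) (by ring) hn2p hn2sl
  · rintro (rfl | rfl)
    · exact one_mem_twoIsogenySelmerGroup 0 hb
    · refine mem_twoIsogenySelmerGroup_of_isSquare hb ?_ ⟨4 * s ^ 2 * q ^ 2 * l ^ 2 * p ^ 2, by ring⟩ ⟨2 * s * q * l * p, ?_⟩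
      · exact Int.squarefree_natAbs.mp (by rw [Int.natAbs_natCast]; exact hP.prime.squarefree)
      · rw [show (4 * s ^ 2 * q ^ 2 * l ^ 2 * p ^ 3 : ℤ) = (p : ℤ) * (4 * s ^ 2 * q ^ 2 * l ^ 2 * p ^ 2) by ring,
          Int.mul_ediv_cancel_left _ hp0]
        ring

end Summit.BirchSwinnertonDyer.BirchSwinnertonDyer.Theorems.BiquadraticEisensteinDescentHeegnerTwistCouplingInSupplyQuarticMinusTripleCubeDescent

end
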